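import Summits.BirchSwinnertonDyer.BirchSwinnertonDyer.Theorems.PrintCf2SplitBadTwoCMScalarAtVPoints
import Summits.BirchSwinnertonDyer.BirchSwinnertonDyer.Theorems.PrintCf2SplitBadTwoCMPrimaryDyadicTableRelaxed
import Summits.BirchSwinnertonDyer.BirchSwinnertonDyer.Theorems.PrintCf2SplitBadTwoLocalLineCount
import Literature.NumberTheory.EllipticCurves.KummerSelmerStructure
import HarnessLib

/-!
# Crux `PrintCf2.SplitBadTwoRankOneOfFacts` (stmt-BirchSwinnertonDyer-20368), road α v10.3, S3c input (F3)/(PIN), SHARP FORM: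
# on `E(K_v)` the CM endomorphism is `1 − r` MODULO `2^k E(K_v)` AND THE `K`-RATIONAL 2-TORSION — the discrepancy `π_v Q − N·Q − 2^k R` is `T_v`, `2T = 0`

Cell `bsd-print-cf2`, EXTRA WIDTH seat `bsd-line-cf2-p1-w3` g10 (prover-bsd-line-cf2-p1-w3-g10-0); `--supports stmt-BirchSwinnertonDyer-20368`
(helper, Theses-free). HONEST FRAMING: nothing here closes the crux or a registered stub; BSD is not proved by any of this; no summit statement
is proved by this seat. No definition, no named fact, no `sorry`, no kit. beyond-print theorem: no.

WHY. The (PI) 𝒪_K-combination of the (F3) plain road (LEAD cf2-p1 g13 ASSIGN 2026-08-28T23:58:11Z → -w6 g4: «`E(K)_v + 2^N E(K_v) = ℤ·P_v + E[2]_v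
+ 2^N E(K_v)`») needs `π_v P_v ∈ ℤ·P_v + E[2]_v + 2^N E(K_v)`. Files 1–2 (`cmScalar_localPoints_of_frame`, `cmScalar_pointHom_of_frame`) give
`π_v Q − N·Q ∈ 2^k E(K_v) + E(K_v)_tors` (`N ≡ 1 − r`); for `d ≡ 3 (8)` the local torsion `E(K_v)[2^∞]` has `8 > 4 = #E[2]` elements, so the
discrepancy must be shown to be `2`-TORSION. THIS FILE proves it, again algebraically:
* §1 (pure algebra, any additive group `G`, `f : G → G` with `f² = f − 2`): `apply_sub_smul_scalarStep` — for `s = f Q − N Q − 2^k R` and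
  `N² − N + 2 = 2^k t`: `f s − (1 − N) s = 2^k·(−tQ + (1 − N)R − f R)`; `exists_twoPow_torsion_eigen` — if `2^a·b` (`b` odd) kills `G_tors`,
  `k ≥ a` and `s` is torsion, then after changing `R` the discrepancy `s` is `2^a`-torsion with `f s = (1 − N)·s` EXACTLY (the odd part of `s` is
  `2^k`-divisible; `f s − (1 − N)s` is `2`-power torsion AND a `2^k`-th multiple, hence `0`).
* §2 `exists_two_torsion_baseChange_eq_of_eigen_of_frame` / `two_smul_eq_zero_of_torsion_eigen_of_frame` — ON THE S3c FRAME (pinning clause at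
  `v`), a `2`-power torsion point `x ∈ E(K_v)` with `f x = M·x`, `M ≡ r`, is the base change of a `K`-RATIONAL `2`-torsion point: along
  `ψ : E(K_v) ↪ E(K̄_v)` and `torsionPointsEquiv` it is a `D_v`-fixed point of `W* = E[𝔮_r^∞]` (`mem_endEigenPrimaryTorsion_iff`),
  `#(W*)^{D_v} = 2` (-w2 g9 `natCard_fixedPoints_decomp_v_eq_two_of_frame`, p663559), and `Γ_K` acts on `W*[2]` by scalars
  (`endEigenPrimaryTorsion_two_structure`), hence trivially; Galois descent `exists_toGeomPoints_eq_of_forall_smul_eq`.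
* §3 **`cmScalar_pointHom_two_torsion_of_frame`** — frame, `φ` realising `π`, ANY descended `f` (`ψ ∘ f = φ_{K_v} ∘ ψ`): `∃ k₀, ∀ k ≥ k₀`, for every
  integer `N ≡ 1 − r (mod 2^k)` and every `Q ∈ E(K_v)` there are `R ∈ E(K_v)` and a `K`-point `T` with **`2·T = 0` and
  `f Q − N·Q − 2^k·R = Affine.Point.baseChange K K_v T`**.
USE: -w6 g4 / -w8 g3 take `Q := P_v` (`f P_v = (πP)_v` by `hf` + `Isogeny.localPointsMap_pointsMap`) and read `πP_v ∈ N·P_v + 2^k E(K_v) + E(K)[2]_v`.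
presearch: as files 1–2 ([corpus:silverman1994-advanced-topics II §1–§2], [corpus: Rubin1999 §3 Lemma 3.6 (ii)], [corpus: Agboola2007 §6 Prop. 6.11]);
no Literature fact filed. playbook: none fit.

References: [Rubin1999] §2 (`E[𝔭^∞]`), §3 Lemma 3.6 (ii); [Agboola2007] §6 Prop. 6.11; [SilvermanAEC2009] Cor. III.6.4, Prop. VII.6.3, VIII §1.
-/

noncomputable section

open scoped Classical

set_option linter.dupNamespace false
set_option autoImplicit false

open NumberField IsDedekindDomain Field WeierstrassCurve
open Literature.NumberTheory.EllipticCurves Literature.NumberTheory.EllipticCurves.GreenbergSelmer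
open Literature.NumberTheory.EllipticCurves.Castella2018.AcSelmer
open Literature.NumberTheory.EllipticCurves.Agboola2007
open Literature.NumberTheory.EllipticCurves.ResKernel
open Literature.NumberTheory.GaloisRepresentations

namespace Summit.BirchSwinnertonDyer.BirchSwinnertonDyer.Theorems.PrintCf2.CMPrimes

open Summit.BirchSwinnertonDyer.BirchSwinnertonDyer.Theorems.PrintCf2.RestrictedSelmerPair
open Summit.BirchSwinnertonDyer.BirchSwinnertonDyer.Theorems.PrintCf2.AdditiveAtSeven
open Summit.BirchSwinnertonDyer.BirchSwinnertonDyer.Theorems.PrintCf2.LocalTrichotomy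
open Summit.BirchSwinnertonDyer.BirchSwinnertonDyer.Theorems.PrintCf2.LocalPointsScalar
open Summit.BirchSwinnertonDyer.BirchSwinnertonDyer.Theorems.PrintCf2.LocalLineCount

/-! ## §1. Pure algebra: the discrepancy is an eigenvector for the conjugate root -/

section Algebra

variable {G : Type*} [AddCommGroup G]

/-- An integer `2`-adically divisible by `2^k` is divisible by `2^k`. [folklore] -/
theorem twoPow_dvd_of_intCast_mem_span {k : ℕ} {x : ℤ} (hx : ((x : ℤ_[2]) : ℤ_[2]) ∈ (Ideal.span {(2 : ℤ_[2]) ^ k} : Ideal ℤ_[2])) :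
    (2 ^ k : ℤ) ∣ x := by
  haveI : Fact (Nat.Prime 2) := ⟨Nat.prime_two⟩
  have h : ‖((x : ℤ_[2]) : ℤ_[2])‖ ≤ (2 : ℝ) ^ (-(k : ℤ)) := by
    have := (PadicInt.norm_le_pow_iff_mem_span_pow ((x : ℤ_[2]) : ℤ_[2]) k).mpr (by exact_mod_cast hx)
    exact_mod_cast this
  exact_mod_cast (PadicInt.norm_int_le_pow_iff_dvd (p := 2)).mp h

/-- **`N² − N + 2 ≡ 0 (mod 2^k)` for `N ≡ 1 − r`** (`r² = r − 2`): `N² − N + 2 = (N − (1 − r))(N − r)` in `ℤ₂`. [folklore] -/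
theorem exists_sq_sub_add_two_eq_twoPow_mul {r : ℤ_[2]} (hr : r * r = r - 2) {k : ℕ} {N : ℤ}
    (hN : ((N : ℤ_[2]) - (1 - r)) ∈ (Ideal.span {(2 : ℤ_[2]) ^ k} : Ideal ℤ_[2])) :
    ∃ t : ℤ, N * N - N + 2 = 2 ^ k * t := by
  have hmem : (((N * N - N + 2 : ℤ) : ℤ_[2]) : ℤ_[2]) ∈ (Ideal.span {(2 : ℤ_[2]) ^ k} : Ideal ℤ_[2]) := by
    have h := Ideal.mul_mem_right ((N : ℤ_[2]) - r) _ hN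
    have e : ((N : ℤ_[2]) - (1 - r)) * ((N : ℤ_[2]) - r) = ((N * N - N + 2 : ℤ) : ℤ_[2]) := by
      push_cast
      linear_combination (-1 : ℤ_[2]) * hr
    rwa [e] at h
  exact twoPow_dvd_of_intCast_mem_span hmem

/-- **The scalar step.** For `f : G → G` additive with `f(f x) = f x − 2x`, `N² − N + 2 = 2^k t` and `s = f Q − N Q − 2^k R`:
`f s − (1 − N)·s = 2^k·(−tQ + ((1 − N)R − f R))` — the discrepancy of the scalar `N` is an eigenvector for the CONJUGATE scalar `1 − N`
up to `2^k G`. [folklore] -/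
theorem apply_sub_smul_scalarStep (f : G →+ G) (hf : ∀ x, f (f x) = f x - (2 : ℤ) • x) {k : ℕ} {N t : ℤ}
    (hN : N * N - N + 2 = 2 ^ k * t) (Q R : G) :
    f (f Q - N • Q - ((2 : ℤ) ^ k) • R) - (1 - N) • (f Q - N • Q - ((2 : ℤ) ^ k) • R) =
      ((2 : ℤ) ^ k) • (-(t • Q) + ((1 - N) • R - f R)) := by
  have hQ : (N * N - N + 2) • Q = ((2 : ℤ) ^ k) • (t • Q) := by rw [hN, mul_smul]
  rw [smul_add, smul_neg, ← hQ, map_sub, map_sub, map_zsmul, map_zsmul, hf]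
  module

variable [hp : Fact (Nat.Prime 2)]

/-- **The discrepancy can be taken `2`-power torsion and is then an EXACT eigenvector for `1 − N`.** If `2^a·b` (`b` odd) kills the torsion of
`G`, `k ≥ a`, `N² − N + 2 = 2^k t` and `f Q − N Q − 2^k R₀` is torsion, then `f Q − N Q − 2^k R = s` for some `R` with `2^a·s = 0` and
`f s = (1 − N)·s`. [folklore] -/
theorem exists_twoPow_torsion_eigen (f : G →+ G) (hf : ∀ x, f (f x) = f x - (2 : ℤ) • x) {a b : ℕ} (hb : ¬ 2 ∣ b)
    (htors : ∀ t : G, IsOfFinAddOrder t → (2 ^ a * b) • t = 0) {k : ℕ} (hk : a ≤ k) {N t : ℤ} (hN : N * N - N + 2 = 2 ^ k * t)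
    (Q R₀ : G) (hR₀ : IsOfFinAddOrder (f Q - N • Q - ((2 : ℤ) ^ k) • R₀)) :
    ∃ R s : G, f Q - N • Q - ((2 : ℤ) ^ k) • R = s ∧ 2 ^ a • s = 0 ∧ f s = (1 - N) • s := by
  have h2k : ((2 : ℤ) ^ k) = ((2 ^ k : ℕ) : ℤ) := by push_cast; rfl
  -- split off the odd part of the torsion discrepancy
  obtain ⟨s, s', hs, hs', hss'⟩ := exists_add_eq_of_pow_mul_smul_eq_zero (p := 2) hb (htors _ hR₀)
  obtain ⟨y₁, hy₁⟩ := exists_pow_nsmul_eq_of_nsmul_eq_zero (p := 2) hb k hs'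
  refine ⟨R₀ + y₁, s, ?_, hs, ?_⟩
  · rw [smul_add, h2k, natCast_zsmul y₁, hy₁, ← sub_sub, ← h2k]
    rw [← hss', add_sub_cancel_right]
  · -- `f s − (1 − N)s` is `2`-power torsion and a `2^k`-th multiple, hence zero
    have hseq : f Q - N • Q - ((2 : ℤ) ^ k) • (R₀ + y₁) = s := by
      rw [smul_add, h2k, natCast_zsmul y₁, hy₁, ← sub_sub, ← h2k, ← hss', add_sub_cancel_right]
    have hstep := apply_sub_smul_scalarStep f hf hN Q (R₀ + y₁)
    rw [hseq] at hstep
    set z : G := -(t • Q) + ((1 - N) • (R₀ + y₁) - f (R₀ + y₁)) with hz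
    -- `2^a` kills `f s − (1 − N)s`
    have hfs : 2 ^ a • f s = 0 := by rw [← map_nsmul, hs, map_zero]
    have hkill : 2 ^ a • (f s - (1 - N) • s) = 0 := by rw [smul_sub, hfs, smul_comm, hs, smul_zero, sub_zero]
    -- hence `2^a z = 0` (Bézout with the odd killer `b` of the torsion point `z`)
    have hzt : IsOfFinAddOrder z := by
      have h1 : 2 ^ (a + k) • z = 0 := by
        rw [pow_add, mul_nsmul', ← natCast_zsmul z (2 ^ k), ← h2k, ← hstep, hkill]
      exact isOfFinAddOrder_iff_nsmul_eq_zero.mpr ⟨2 ^ (a + k), pow_pos two_pos _, h1⟩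
    have haz : 2 ^ a • z = 0 := by
      refine eq_zero_of_pow_nsmul_of_nsmul (p := 2) (a := k) hb ?_ ?_
      · rw [← mul_nsmul', ← pow_add, add_comm]
        rw [pow_add, mul_nsmul', ← natCast_zsmul z (2 ^ k), ← h2k, ← hstep, hkill]
      · rw [← mul_nsmul', mul_comm, htors z hzt]
    have hkz : ((2 : ℤ) ^ k) • z = 0 := by
      rw [h2k, natCast_zsmul, show 2 ^ k = 2 ^ (k - a) * 2 ^ a by rw [← pow_add, Nat.sub_add_cancel hk], mul_nsmul', haz, smul_zero]
    rw [hkz] at hstep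
    exact sub_eq_zero.mp hstep

end Algebra

/-! ## §2. On the frame: a `2`-power torsion point of `E(K_v)` in the `r`-eigenspace is `2`-torsion -/

variable {K : Type} [Field K] [NumberField K]

/-- Two integers approximating the same `p`-adic integer to order `p^k` act alike on a point killed by `p^k`. [folklore] -/
theorem zsmul_eq_zsmul_of_sub_mem_span {M : Type*} [AddCommGroup M] {p : ℕ} [Fact p.Prime] {k : ℕ} {x : M} (hx : p ^ k • x = 0)
    {r : ℤ_[p]} {N N' : ℤ} (hN : ((N : ℤ_[p]) - r) ∈ (Ideal.span {(p : ℤ_[p]) ^ k} : Ideal ℤ_[p]))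
    (hN' : ((N' : ℤ_[p]) - r) ∈ (Ideal.span {(p : ℤ_[p]) ^ k} : Ideal ℤ_[p])) : N • x = N' • x := by
  have h : ((N - N' : ℤ) : ℤ_[p]) ∈ (Ideal.span {(p : ℤ_[p]) ^ k} : Ideal ℤ_[p]) := by
    have := Ideal.sub_mem _ hN hN'
    push_cast
    convert this using 1
    ring
  have hdvd : (p ^ k : ℤ) ∣ N - N' := by
    rw [← PadicInt.norm_int_le_pow_iff_dvd]
    exact (PadicInt.norm_le_pow_iff_mem_span_pow _ _).mpr h
  obtain ⟨c, hc⟩ := hdvd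
  have hpk : ((p : ℤ) ^ k) • x = 0 := by
    rw [show ((p : ℤ) ^ k) = ((p ^ k : ℕ) : ℤ) by push_cast; rfl, natCast_zsmul, hx]
  have h1 : (N - N') • x = 0 := by rw [hc, mul_comm, mul_zsmul, hpk, zsmul_zero]
  rw [sub_smul] at h1
  exact sub_eq_zero.mp h1

/-- **A `2`-power torsion point of `E(K_v)` in the `r`-eigenspace of the CM endomorphism is a `K`-RATIONAL `2`-torsion point**, on every
S3c frame (pinning clause at `v`): if `x ∈ E(K_v)` (`= ((W.baseChange K).baseChange K_v).toAffine.Point`), `2^a x = 0` and `f x = M·x` for the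
descended `f` (`ψ ∘ f = φ_{K_v} ∘ ψ`) and an integer `M ≡ r (mod 2^a)`, then `x = T_v` for a `K`-point `T` with `2T = 0`. Indeed `ψ x = ι_* y` for a
torsion point `y ∈ E(K̄)` (`torsionPointsEquiv`); `y` is `D_v`-fixed with `π y = M y`, so `y ∈ (E[𝔮_r^∞])^{D_v}`, a group of order `2`
(`natCard_fixedPoints_decomp_v_eq_two_of_frame`), so `2y = 0`; and `Γ_K` acts on `E[𝔮_r^∞][2]` by scalars (`endEigenPrimaryTorsion_two_structure`),
hence trivially, so `y` descends to `K`. [cite: Rubin1999, §2, §3 Lemma 3.6 (ii) and Prop. 5.4] [cite: SilvermanAEC2009, Cor. III.6.4, VIII §1] -/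
theorem exists_two_torsion_baseChange_eq_of_eigen_of_frame {d : ℤ} (hd0 : d ≠ 0) (hsq : Squarefree d) (hd4 : d % 4 ≠ 1)
    (W : WeierstrassCurve ℚ) [W.IsElliptic] (C : VariableChange ℚ) (hCW : C • W = cm7.quadraticTwist (d : ℚ)) (hK : IsImaginaryQuadratic K)
    (v vbar : HeightOneSpectrum (𝓞 K)) (hv : ((2 : ℕ) : 𝓞 K) ∈ v.asIdeal) (hvbar : ((2 : ℕ) : 𝓞 K) ∈ vbar.asIdeal) (hne : vbar ≠ v)
    (π : (W.baseChange K).endRing) (hrel : (π : AddMonoid.End (W.baseChange K).geomPoints) * π = π - 2)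
    {r : ℤ_[2]} (hr : r * r = r - 2)
    (hpin : ∀ τ ∈ GreenbergSelmer.inertia v, ∀ x : ↥((W.baseChange K).endEigenPrimaryTorsion 2 π r), τ • x = x ∨ τ • x = -x)
    (φ : Isogeny (W.baseChange K) (W.baseChange K)) (hφ : ∀ Q, φ Q = (π : AddMonoid.End (W.baseChange K).geomPoints) Q)
    (f : ((W.baseChange K).baseChange (v.adicCompletion K)).toAffine.Point →+
      ((W.baseChange K).baseChange (v.adicCompletion K)).toAffine.Point)
    (hf : ∀ Q, Affine.Point.map (W' := W.baseChange K)
        (IsScalarTower.toAlgHom K (v.adicCompletion K) (AlgebraicClosure (v.adicCompletion K))) (f Q) =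
      φ.localPointsMap (v.adicCompletion K) (Affine.Point.map (W' := W.baseChange K)
        (IsScalarTower.toAlgHom K (v.adicCompletion K) (AlgebraicClosure (v.adicCompletion K))) Q))
    {a : ℕ} {M : ℤ} (hM : ((M : ℤ_[2]) - r) ∈ (Ideal.span {(2 : ℤ_[2]) ^ a} : Ideal ℤ_[2]))
    (x : ((W.baseChange K).baseChange (v.adicCompletion K)).toAffine.Point) (hx : 2 ^ a • x = 0) (hfx : f x = M • x) :
    ∃ T : (W.baseChange K).toAffine.Point, 2 • T = 0 ∧
      Affine.Point.baseChange (W' := W.baseChange K) K (v.adicCompletion K) T = x := by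
  haveI : Fact (Nat.Prime 2) := ⟨Nat.prime_two⟩
  haveI : CharZero (v.adicCompletion K) := charZero_of_injective_algebraMap (algebraMap K (v.adicCompletion K)).injective
  set ψ : ((W.baseChange K).baseChange (v.adicCompletion K)).toAffine.Point →+ localPoints (W.baseChange K) (v.adicCompletion K) :=
    Affine.Point.map (W' := W.baseChange K) (IsScalarTower.toAlgHom K (v.adicCompletion K) (AlgebraicClosure (v.adicCompletion K)))
    with hψ
  have hψinj : Function.Injective ψ :=
    Affine.Point.map_injective (W' := W.baseChange K)
      (IsScalarTower.toAlgHom K (v.adicCompletion K) (AlgebraicClosure (v.adicCompletion K)))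
  have hψfix : ∀ σ : absoluteGaloisGroup (v.adicCompletion K), σ • ψ x = ψ x :=
    fun σ ↦ smul_map_baseChange_eq (W.baseChange K) (v.adicCompletion K) ψ hψ x σ
  -- `ψ x` is `2^a`-torsion, hence algebraic: `ψ x = ι_* y`
  have h2a0 : ((2 ^ a : ℕ) : ℤ) ≠ 0 := by exact_mod_cast pow_ne_zero a two_ne_zero
  have hψx : 2 ^ a • ψ x = 0 := by rw [← map_nsmul, hx, map_zero]
  set Tx : AddSubgroup.torsionBy (localPoints (W.baseChange K) (v.adicCompletion K)) ((2 ^ a : ℕ) : ℤ) :=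
    ⟨ψ x, AddSubgroup.torsionBy.nsmul_iff.mpr hψx⟩ with hTx
  set y : geomTorsion (W.baseChange K) ((2 ^ a : ℕ) : ℤ) :=
    ((W.baseChange K).torsionPointsEquiv ((2 ^ a : ℕ) : ℤ) (E := v.adicCompletion K) h2a0).symm Tx with hy
  have hyx : pointsMap (W.baseChange K) (v.adicCompletion K) (y : (W.baseChange K).geomPoints) = ψ x := by
    rw [hy, (W.baseChange K).pointsMap_torsionPointsEquiv_symm ((2 ^ a : ℕ) : ℤ) h2a0 Tx]
  have hy2a : 2 ^ a • (y : (W.baseChange K).geomPoints) = 0 := AddSubgroup.torsionBy.nsmul_iff.mp y.2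
  -- `y` as a `2`-primary point, fixed by `D_v`, in the `r`-eigenspace
  have hymem : (y : (W.baseChange K).geomPoints) ∈ (W.baseChange K).geomPrimaryTorsion 2 :=
    (AddCommGroup.mem_primaryComponent).mpr ⟨a, hy2a⟩
  set m : (W.baseChange K).geomPrimaryTorsion 2 := ⟨(y : (W.baseChange K).geomPoints), hymem⟩ with hm
  have hinjpm : Function.Injective (pointsMap (W.baseChange K) (v.adicCompletion K)) :=
    pointsMapOfEmb_injective (W.baseChange K) (closureEmb (K := K) (v.adicCompletion K))
  have hmfix : ∀ δ ∈ decomp v, δ • m = m := by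
    intro δ hδ
    obtain ⟨τ, rfl⟩ := (mem_decomp_iff v δ).mp hδ
    apply Subtype.ext
    change resGal (K := K) (v.adicCompletion K) τ • (y : (W.baseChange K).geomPoints) = y
    apply hinjpm
    rw [pointsMap_smul, hyx, hψfix]
  have hπy : (π : AddMonoid.End (W.baseChange K).geomPoints) (y : (W.baseChange K).geomPoints) =
      M • (y : (W.baseChange K).geomPoints) := by
    apply hinjpm
    rw [← hφ, ← φ.localPointsMap_pointsMap, hyx, map_zsmul, hyx, ← map_zsmul, ← hfx]
    exact (hf x).symm
  have hmW : m ∈ (W.baseChange K).endEigenPrimaryTorsion 2 π r := by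
    rw [mem_endEigenPrimaryTorsion_iff]
    intro k N hk hN
    change (π : AddMonoid.End (W.baseChange K).geomPoints) (y : (W.baseChange K).geomPoints) =
      N • (y : (W.baseChange K).geomPoints)
    rw [hπy]
    have hky : 2 ^ k • (y : (W.baseChange K).geomPoints) = 0 := by
      have h := congrArg Subtype.val hk
      rw [AddSubmonoidClass.coe_nsmul, ZeroMemClass.coe_zero] at h
      exact h
    -- compare `M` and `N` at the smaller of the two levels
    rcases le_total k a with hka | hak
    · exact zsmul_eq_zsmul_of_sub_mem_span (p := 2) hky
        ((Ideal.span_singleton_le_span_singleton.mpr (pow_dvd_pow _ hka)) hM) hN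
    · exact zsmul_eq_zsmul_of_sub_mem_span (p := 2) hy2a hM
        ((Ideal.span_singleton_le_span_singleton.mpr (pow_dvd_pow _ hak)) hN)
  -- the fixed-point group of `W*` under `D_v` has two elements, so `2 y = 0`
  have hcard := natCard_fixedPoints_decomp_v_eq_two_of_frame hd0 hsq hd4 W C hCW hK v vbar hv hvbar hne π hrel hr hpin
  set w : ↥((W.baseChange K).endEigenPrimaryTorsion 2 π r) := ⟨m, hmW⟩ with hw
  have hwfix : w ∈ FixedPoints.addSubgroup (decomp v) ↥((W.baseChange K).endEigenPrimaryTorsion 2 π r) := by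
    rw [FixedPoints.mem_addSubgroup]
    intro δ
    apply Subtype.ext
    exact hmfix δ δ.2
  haveI : Finite (FixedPoints.addSubgroup (decomp v) ↥((W.baseChange K).endEigenPrimaryTorsion 2 π r)) :=
    Nat.finite_of_card_ne_zero (by rw [hcard]; norm_num)
  have h2w : 2 • (⟨w, hwfix⟩ : FixedPoints.addSubgroup (decomp v) ↥((W.baseChange K).endEigenPrimaryTorsion 2 π r)) = 0 := by
    have h := card_nsmul_eq_zero'
      (x := (⟨w, hwfix⟩ : FixedPoints.addSubgroup (decomp v) ↥((W.baseChange K).endEigenPrimaryTorsion 2 π r)))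
    rwa [hcard] at h
  have h2w' : 2 • w = 0 := by
    have h := congrArg Subtype.val h2w
    rw [AddSubmonoidClass.coe_nsmul, ZeroMemClass.coe_zero] at h
    exact h
  have h2m : 2 • m = 0 := by
    have h := congrArg Subtype.val h2w'
    rw [AddSubmonoidClass.coe_nsmul, ZeroMemClass.coe_zero] at h
    exact h
  have h2y : 2 • (y : (W.baseChange K).geomPoints) = 0 := by
    have h := congrArg Subtype.val h2m
    rw [AddSubmonoidClass.coe_nsmul, ZeroMemClass.coe_zero] at h
    exact h
  -- `Γ_K` acts on `W*[2]` by scalars, hence trivially: `y` is `Γ_K`-fixed and descends to `K`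
  have hj : W.j = -3375 := j_eq_of_smul_eq_cm7Twist hd0 W C hCW
  obtain ⟨θ, hθ⟩ := exists_sq_eq_neg_seven_of_cmEndo_mem_endRing W K hj π hrel
  obtain ⟨-, -, -, -, -, -, -, hscal⟩ := endEigenPrimaryTorsion_two_structure W hj K hθ π hrel hr
  have hyfix : ∀ σ : absoluteGaloisGroup K, σ • (y : (W.baseChange K).geomPoints) = y := by
    intro σ
    obtain ⟨N, hN⟩ := hscal σ 1
    have hσm : σ • m = N • m := hN m hmW (by rw [pow_one]; exact h2m)
    have hσm' : σ • m = m := by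
      obtain ⟨c, hc | hc⟩ := Int.even_or_odd' N
      · -- `N = 2c`: `σ • m = c • (2 • m) = 0`, so `m = 0`
        have h0 : σ • m = 0 := by
          rw [hσm, hc, mul_comm, mul_zsmul, two_zsmul, ← two_nsmul, h2m, zsmul_zero]
        have hm0 : m = 0 := by
          have := congrArg (fun z ↦ σ⁻¹ • z) h0
          simpa only [inv_smul_smul, smul_zero] using this
        rw [hm0, smul_zero]
      · -- `N = 2c + 1`: `σ • m = m + c • (2 • m) = m`
        rw [hσm, hc, add_zsmul, one_zsmul, mul_comm, mul_zsmul, two_zsmul, ← two_nsmul, h2m, zsmul_zero, zero_add]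
    have h1 := congrArg Subtype.val hσm'
    rw [primaryComponent.coe_smul] at h1
    exact h1
  obtain ⟨T, hT⟩ := exists_toGeomPoints_eq_of_forall_smul_eq (W := W.baseChange K) hyfix
  refine ⟨T, ?_, ?_⟩
  · apply toGeomPoints_injective (W.baseChange K)
    rw [map_nsmul, hT, h2y, map_zero]
  · apply hψinj
    have hjT : ψ (Affine.Point.baseChange (W' := W.baseChange K) K (v.adicCompletion K) T) =
        pointsMap (W.baseChange K) (v.adicCompletion K) (toGeomPoints (W.baseChange K) T) := by
      rw [hψ]
      change Affine.Point.map _ (Affine.Point.baseChange (W' := W.baseChange K) K (v.adicCompletion K) T) =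
        Affine.Point.map (closureEmb (K := K) (v.adicCompletion K))
          (Affine.Point.baseChange (W' := W.baseChange K) K (AlgebraicClosure K) T)
      rw [Affine.Point.map_baseChange, Affine.Point.map_baseChange]
    rw [hjT, hT, hyx]

/-- **Corollary: such a point is `2`-torsion.** [cite: Rubin1999, §2 and §3 Lemma 3.6 (ii)] [cite: SilvermanAEC2009, Cor. III.6.4, VIII §1] -/
theorem two_smul_eq_zero_of_torsion_eigen_of_frame {d : ℤ} (hd0 : d ≠ 0) (hsq : Squarefree d) (hd4 : d % 4 ≠ 1)
    (W : WeierstrassCurve ℚ) [W.IsElliptic] (C : VariableChange ℚ) (hCW : C • W = cm7.quadraticTwist (d : ℚ)) (hK : IsImaginaryQuadratic K)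
    (v vbar : HeightOneSpectrum (𝓞 K)) (hv : ((2 : ℕ) : 𝓞 K) ∈ v.asIdeal) (hvbar : ((2 : ℕ) : 𝓞 K) ∈ vbar.asIdeal) (hne : vbar ≠ v)
    (π : (W.baseChange K).endRing) (hrel : (π : AddMonoid.End (W.baseChange K).geomPoints) * π = π - 2)
    {r : ℤ_[2]} (hr : r * r = r - 2)
    (hpin : ∀ τ ∈ GreenbergSelmer.inertia v, ∀ x : ↥((W.baseChange K).endEigenPrimaryTorsion 2 π r), τ • x = x ∨ τ • x = -x)
    (φ : Isogeny (W.baseChange K) (W.baseChange K)) (hφ : ∀ Q, φ Q = (π : AddMonoid.End (W.baseChange K).geomPoints) Q)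
    (f : ((W.baseChange K).baseChange (v.adicCompletion K)).toAffine.Point →+
      ((W.baseChange K).baseChange (v.adicCompletion K)).toAffine.Point)
    (hf : ∀ Q, Affine.Point.map (W' := W.baseChange K)
        (IsScalarTower.toAlgHom K (v.adicCompletion K) (AlgebraicClosure (v.adicCompletion K))) (f Q) =
      φ.localPointsMap (v.adicCompletion K) (Affine.Point.map (W' := W.baseChange K)
        (IsScalarTower.toAlgHom K (v.adicCompletion K) (AlgebraicClosure (v.adicCompletion K))) Q))
    {a : ℕ} {M : ℤ} (hM : ((M : ℤ_[2]) - r) ∈ (Ideal.span {(2 : ℤ_[2]) ^ a} : Ideal ℤ_[2]))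
    (x : ((W.baseChange K).baseChange (v.adicCompletion K)).toAffine.Point) (hx : 2 ^ a • x = 0) (hfx : f x = M • x) :
    2 • x = 0 := by
  obtain ⟨T, h2T, hTx⟩ := exists_two_torsion_baseChange_eq_of_eigen_of_frame hd0 hsq hd4 W C hCW hK v vbar hv hvbar hne π hrel hr hpin
    φ hφ f hf hM x hx hfx
  rw [← hTx, ← map_nsmul]
  exact (congrArg (Affine.Point.baseChange (W' := W.baseChange K) K (v.adicCompletion K)) h2T).trans (map_zero _)

/-! ## §3. The sharp form on the frame -/

/-- **THE CM SCALAR AT `v`, SHARP FORM: the discrepancy is `2`-torsion.** On an S3c frame (pinning clause at `v`, `P ∈ W(ℚ)` of infinite order,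
`Finite 𝔖_{v̄}(K, E[𝔮_r^∞])`), for the isogeny `φ` realising `π` and ANY descended `f : E(K_v) → E(K_v)` (`ψ ∘ f = φ_{K_v} ∘ ψ`): there is `k₀`
such that for all `k ≥ k₀`, every integer `N ≡ 1 − r (mod 2^k)` and every `Q ∈ E(K_v)` one has `f Q − N·Q − 2^k·R = T_v` for some `R ∈ E(K_v)`
and some `K`-RATIONAL point `T` with `2·T = 0` (`T_v = Affine.Point.baseChange K K_v T`). So `π_v Q ∈ N·Q + 2^k E(K_v) + E(K)[2]_v` — the
input of the (PI) 𝒪_K-combination «`E(K)_v + 2^N E(K_v) = ℤ·P_v + E[2]_v + 2^N E(K_v)`» (LEAD cf2-p1 g13 2026-08-28T23:58:11Z). [cite: Rubin1999, §3 Lemma 3.6 (ii)]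
[cite: Agboola2007, §6 Prop. 6.11 (arXiv p0014)] [cite: SilvermanAEC2009, Prop. VII.6.3, Cor. III.6.4] -/
theorem cmScalar_pointHom_two_torsion_of_frame {d : ℤ} (hd0 : d ≠ 0) (hsq : Squarefree d) (hd4 : d % 4 ≠ 1)
    (W : WeierstrassCurve ℚ) [W.IsElliptic] (C : VariableChange ℚ) (hCW : C • W = cm7.quadraticTwist (d : ℚ)) (hK : IsImaginaryQuadratic K)
    (v vbar : HeightOneSpectrum (𝓞 K)) (hv : ((2 : ℕ) : 𝓞 K) ∈ v.asIdeal) (hvbar : ((2 : ℕ) : 𝓞 K) ∈ vbar.asIdeal) (hne : vbar ≠ v)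
    (π : (W.baseChange K).endRing) (hrel : (π : AddMonoid.End (W.baseChange K).geomPoints) * π = π - 2)
    {r : ℤ_[2]} (hr : r * r = r - 2)
    (hpin : ∀ τ ∈ GreenbergSelmer.inertia v, ∀ x : ↥((W.baseChange K).endEigenPrimaryTorsion 2 π r), τ • x = x ∨ τ • x = -x)
    (P : W.toAffine.Point) (hP : ¬ IsOfFinAddOrder P)
    (hfin : Finite (restrictedSelmerBase ↥((W.baseChange K).endEigenPrimaryTorsion 2 π r) 2 vbar))
    (φ : Isogeny (W.baseChange K) (W.baseChange K)) (hφ : ∀ Q, φ Q = (π : AddMonoid.End (W.baseChange K).geomPoints) Q)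
    (f : ((W.baseChange K).baseChange (v.adicCompletion K)).toAffine.Point →+
      ((W.baseChange K).baseChange (v.adicCompletion K)).toAffine.Point)
    (hf : ∀ Q, Affine.Point.map (W' := W.baseChange K)
        (IsScalarTower.toAlgHom K (v.adicCompletion K) (AlgebraicClosure (v.adicCompletion K))) (f Q) =
      φ.localPointsMap (v.adicCompletion K) (Affine.Point.map (W' := W.baseChange K)
        (IsScalarTower.toAlgHom K (v.adicCompletion K) (AlgebraicClosure (v.adicCompletion K))) Q)) :
    ∃ k₀ : ℕ, ∀ k : ℕ, k₀ ≤ k → ∀ N : ℤ, ((N : ℤ_[2]) - (1 - r)) ∈ (Ideal.span {(2 : ℤ_[2]) ^ k} : Ideal ℤ_[2]) →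
      ∀ Q : ((W.baseChange K).baseChange (v.adicCompletion K)).toAffine.Point,
        ∃ (R : ((W.baseChange K).baseChange (v.adicCompletion K)).toAffine.Point) (T : (W.baseChange K).toAffine.Point),
          2 • T = 0 ∧ f Q - N • Q - ((2 : ℤ) ^ k) • R = Affine.Point.baseChange (W' := W.baseChange K) K (v.adicCompletion K) T := by
  haveI : Fact (Nat.Prime 2) := ⟨Nat.prime_two⟩
  haveI : CharZero (v.adicCompletion K) := charZero_of_injective_algebraMap (algebraMap K (v.adicCompletion K)).injective
  haveI : ((W.baseChange K).baseChange (v.adicCompletion K)).IsElliptic :=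
    inferInstanceAs (((W.baseChange K).map (algebraMap K (v.adicCompletion K))).IsElliptic)
  -- the torsion of `E(K_v)` is killed by `2^a · b`, `b` odd (Silverman VII.6.3 at `[K_v : ℚ₂] = 1`)
  letI : Algebra ℚ_[2] (v.adicCompletion K) := LocalField.adicCompletionPadicAlgebra v 2 hv
  have h1 : Module.finrank ℚ_[2] (v.adicCompletion K) = 1 := by
    rw [Literature.NumberTheory.NumberFields.finrank_adicCompletionPadicAlgebra_eq 2 v hv]
    exact ramificationIdx_mul_inertiaDeg_eq_one_of_ne hK.1 hv hvbar hne
  haveI : FiniteDimensional ℚ_[2] (v.adicCompletion K) := Module.finite_of_finrank_pos (by rw [h1]; exact one_pos)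
  obtain ⟨U, hU, ⟨eU⟩⟩ :=
    exists_finiteIndex_addEquiv_padicInt_of_finrank_eq_one 2 h1 ((W.baseChange K).baseChange (v.adicCompletion K))
  haveI := hU
  obtain ⟨a, b, hb, htors⟩ := exists_torsion_annihilator U eU
  have hφ2 : ∀ Q, φ (φ Q) = φ Q - 2 • Q := fun Q ↦ by rw [hφ, hφ, cmEndo_apply_apply (W.baseChange K) hrel Q]
  have hf2 := pointHom_apply_apply_of_localPointsMap (W.baseChange K) (v.adicCompletion K) φ hφ2 f hf
  have hscal := cmScalar_pointHom_of_frame hd0 W C hCW hK v vbar hv hvbar hne π hrel hr P hP hfin φ hφ f hf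
  refine ⟨a, fun k hk N hN Q ↦ ?_⟩
  obtain ⟨t, ht⟩ := exists_sq_sub_add_two_eq_twoPow_mul hr hN
  obtain ⟨R₀, hR₀⟩ := hscal k N hN Q
  obtain ⟨R, s, hs, hsa, hfs⟩ := exists_twoPow_torsion_eigen f hf2 hb htors hk ht Q R₀ hR₀
  -- `1 − N ≡ r (mod 2^k)`, hence modulo `2^a`
  have hM : (((1 - N : ℤ) : ℤ_[2]) - r) ∈ (Ideal.span {(2 : ℤ_[2]) ^ a} : Ideal ℤ_[2]) := by
    have hle : (Ideal.span {(2 : ℤ_[2]) ^ k} : Ideal ℤ_[2]) ≤ Ideal.span {(2 : ℤ_[2]) ^ a} :=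
      Ideal.span_singleton_le_span_singleton.mpr (pow_dvd_pow _ hk)
    have h := (Ideal.neg_mem_iff _).mpr (hle hN)
    push_cast
    convert h using 1
    ring
  obtain ⟨T, h2T, hTs⟩ := exists_two_torsion_baseChange_eq_of_eigen_of_frame hd0 hsq hd4 W C hCW hK v vbar hv hvbar hne π hrel hr hpin
    φ hφ f hf hM s hsa hfs
  exact ⟨R, T, h2T, hs.trans hTs.symm⟩

end Summit.BirchSwinnertonDyer.BirchSwinnertonDyer.Theorems.PrintCf2.CMPrimes

end
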